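/-
Copyright: cell pub-balaban-gaps, seat ne8 (estimate NE7c), gen 16. Project licence.
-/
import Literature.MathematicalPhysics.QuantumFieldTheory.Balaban1983to89.T4ShellMeasure

/-!
# Road (δ)'s END-TO-END constructor on the `S`-STAGE PRODUCT MODEL: `S` independent threshold tests per run, ANY probability laws, the
# `2^S` leaves of the decision tree as terms, one slot per stage — `T4ShellMeasure.shellWeightBound_of_liveFactor` FIRES BY NAME with the
# cascade constant `V = S` (the SUM over the stages: for INDEPENDENT tests the (δ-1) member pays §7's count, not §8's product `2(2^S − 1)`);
# consumed of the laws: `Σ_i μ_σ(twoSidedShell_i) ≤ 1` per stage — disjointness alone (row NE7c; junction J-21; MODEL, [folklore])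

Cell `pub-balaban-gaps` (G2), seat ne8, estimate **NE7c** (`T4IndicatorShell.ShellWeightBound`; two-run artefact, NOT PRINTED in [Bałaban 1983–89], NOT
PROVED).  Proof-only file under `Spine/NE7c/`: imports the tree's `Balaban1983to89.T4ShellMeasure` only (`twoSidedShell`, `twoSidedShell_disjoint`,
`candidateCount_spec`, `SlotLedger.of_realized`, `shellWeightBound_of_liveFactor`); companion of this seat's file 37 `LiveFactorOneStageModel` (J-20, the case
`S = 1`; its one-dimensional lemmas are re-derived inline here in product form, not restated).  Mathlib finite products otherwise.  Nothing of Bałaban's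
is named; no `def`; 0 `sorry`.

THE QUESTION (HANDOFF § GEN 15 optional open point (vii), continued; `T4ShellMeasure` §8 «Its price is the constant `V` (a product over the live stages instead
of §7's sum …)»).  File 37 fired the (δ-1) constructor on ONE stage with ONE test.  With `S` stages — the decision tree of [B15] p. 181 «we introduce this
decomposition in each component … separately» read as `S` successive sharp tests — does the constructor still fire on measure-valued data, with which
constant `V`, and what does it consume of the laws?

ANSWER ([folklore]; the PRODUCT model: the `S` tested variables are INDEPENDENT, stage `σ` testing a real variable with law `μ_σ` — ANY probability measure
on `ℝ` — against `θ_{K,σ}·λ_i`, `λ_i = (1 − ρ⋆_K)^i` the COMMON live factor).  Terms = the `2^S` leaves `ω : Fin S → Bool` with weight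
`A(ω) = ∏_σ m_σ(ω_σ)`, `m_σ(small) = μ_σ{u < θλ}`, `m_σ(large) = μ_σ{u ≥ θλ}`; slot `σ`'s piece on leaf `ω` = `e_σ(ω_σ)·∏_{τ ≠ σ} m_τ(ω_τ)` with
`e_σ(small) = μ_σ[θλ(1 − ρ), θλ)`, `e_σ(large) = μ_σ[θλ, θλ(1 + ρ))` (the two halves of the tree's `twoSidedShell`, `2ρ ≤ ρ⋆`); the leaf's SHELL PART =
its weight on «some tested variable in its own shell» `= ∏_σ m_σ − ∏_σ (m_σ − e_σ)`.
* §1 product algebra: **`prod_sub_prod_le_sum`** (the UNION BOUND in product form: `∏ m − ∏ (m − e) ≤ Σ_σ e_σ·∏_{τ≠σ} m_τ` for `0 ≤ e ≤ m` — the ledger's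
  `cover`), `prod_sub_prod_nonneg`, `sum_leaf_total` (`Σ_ω ∏_σ m_σ(ω_σ) = ∏_σ Σ_b m_σ(b)`), `sum_leaf_factor` (`Σ_ω e_σ(ω_σ)∏_{τ≠σ} m_τ(ω_τ) =
  (Σ_b e_σ b)·∏_{τ≠σ} Σ_b m_τ b` — summing the younger AND older stages out).
* §2 the ABSTRACT product slot system (`m e : ℕ → ℕ → Fin S → Bool → ℝ` with `0 ≤ e ≤ m`, `Σ_b m = 1`, `Σ_{i<n_K} Σ_b e_{K,i,σ} ≤ 1` per stage):
  `realizedLedger_product` (for EVERY choice function), `candidateTotals_product_le` (`Σ_i Σ_σ Σ_ω piece ≤ S·1`), **`shellWeightBound_productStages`**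
  (`shellWeightBound_of_liveFactor` FIRES with `V = S`, `Z = 1`, `M = 4c₁∕β′`: `∃ i⋆, (∀ K, i⋆ K < ⌊β′∕(c₁ϑ^K)⌋₊) ∧ ShellWeightBound …` with
  `Wsh K = Σ_σ Σ_b e^A_{K,i⋆K,σ}(b) + Σ_σ Σ_b e^B_{K,i⋆K,σ}(b)`).
* §3 the MEASURE instance: for ANY laws `μ^A_σ, μ^B_σ` (probability measures on `ℝ`), thresholds `θ_{K,σ} ≥ 0`, widths `2ρ^X_{K,σ} ≤ ρ⋆_K = c₁ϑ^K`:
  **`shellWeightBound_productStages_measure`** — `Wsh K = Σ_σ μ^A_σ(twoSidedShell^A_{K,σ,i⋆K}) + Σ_σ μ^B_σ(twoSidedShell^B_{K,σ,i⋆K})`.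

WHAT THIS SHOWS ∕ DOES NOT SHOW (honest).  SHOWS: with `S` INDEPENDENT tests the (δ-1) constructor fires with `V = S` — §7's SUM count — and consumes of the
laws only `Σ_i μ_σ(twoSidedShell_i) ≤ 1` per stage (disjointness); the factor between `S` and §8's cascade count `2(∏_σ(ν_σ + 1) − 1)` is therefore the
price of ADAPTIVITY alone (history-dependent tests), not of the common factor.  DOES NOT SHOW: anything about adaptive (history-dependent) tests, Bałaban's
expansion (node O), or (L1-step).  BY-NAME EFFECT ON THE WALL: none (MODEL).  VERDICT WORD UNCHANGED: WORK-bound behind node O; INSTANCE 0∕1.  NE7c ∕ NE7b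
NOT PRINTED ∕ NOT PROVED; spine 0∕9; one finite T⁴ — NOT ℝ⁴, NOT infinite volume, NOT the mass gap, NOT Clay.
HONEST DEPENDENCY (cell): continuum YM on T⁴ ⇐ BetaPertH ∧ nine spine estimates (0∕9 proved); BetaPertH ⇐ (D1) ∧ (D4) ∧ CAP+tail.
-/

set_option autoImplicit false

noncomputable section

open MeasureTheory Finset Set
open Literature.MathematicalPhysics.QuantumFieldTheory.Balaban1983to89
open Literature.MathematicalPhysics.QuantumFieldTheory.Balaban1983to89.T4ShellMeasure

namespace Summit.QuantumFields.BalabanUV.T4Continuum.Spine.NE7c.LiveFactorProductStageModel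

/-! ## §1 Product algebra: the union bound in product form and the leaf factorizations -/

section Algebra

/-- **THE UNION BOUND IN PRODUCT FORM** (the ledger's `cover` field for independent tests): for `0 ≤ e_a ≤ m_a`,
`∏_s m − ∏_s (m − e) ≤ Σ_{a ∈ s} e_a · ∏_{s ∖ {a}} m`. [folklore] -/
theorem prod_sub_prod_le_sum {α : Type*} [DecidableEq α] (s : Finset α) (m e : α → ℝ)
    (he0 : ∀ a ∈ s, 0 ≤ e a) (hem : ∀ a ∈ s, e a ≤ m a) :
    ∏ a ∈ s, m a - ∏ a ∈ s, (m a - e a) ≤ ∑ a ∈ s, e a * ∏ b ∈ s.erase a, m b := by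
  induction s using Finset.induction_on with
  | empty => simp
  | insert a s ha ih =>
    have he0' : ∀ x ∈ s, 0 ≤ e x := fun x hx => he0 x (mem_insert_of_mem hx)
    have hem' : ∀ x ∈ s, e x ≤ m x := fun x hx => hem x (mem_insert_of_mem hx)
    have hma : 0 ≤ m a := (he0 a (mem_insert_self a s)).trans (hem a (mem_insert_self a s))
    have hPle : ∏ x ∈ s, (m x - e x) ≤ ∏ x ∈ s, m x :=
      prod_le_prod (fun x hx => sub_nonneg.2 (hem' x hx)) (fun x hx => sub_le_self _ (he0' x hx))
    rw [prod_insert ha, prod_insert ha, sum_insert ha, erase_insert ha]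
    have hsplit : ∑ x ∈ s, e x * ∏ b ∈ (insert a s).erase x, m b = m a * ∑ x ∈ s, e x * ∏ b ∈ s.erase x, m b := by
      rw [mul_sum]
      refine sum_congr rfl fun x hx => ?_
      have hxa : x ≠ a := fun h => ha (h ▸ hx)
      rw [erase_insert_of_ne hxa.symm, prod_insert (fun h => ha (mem_of_mem_erase h))]
      ring
    rw [hsplit]
    calc m a * ∏ x ∈ s, m x - (m a - e a) * ∏ x ∈ s, (m x - e x)
        = m a * (∏ x ∈ s, m x - ∏ x ∈ s, (m x - e x)) + e a * ∏ x ∈ s, (m x - e x) := by ring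
      _ ≤ m a * (∑ x ∈ s, e x * ∏ b ∈ s.erase x, m b) + e a * ∏ x ∈ s, m x :=
          add_le_add (mul_le_mul_of_nonneg_left (ih he0' hem') hma) (mul_le_mul_of_nonneg_left hPle (he0 a (mem_insert_self a s)))
      _ = e a * ∏ x ∈ s, m x + m a * ∑ x ∈ s, e x * ∏ b ∈ s.erase x, m b := by ring

/-- The shell part `∏ m − ∏ (m − e)` is nonnegative for `0 ≤ e ≤ m`. [folklore] -/
theorem prod_sub_prod_nonneg {α : Type*} (s : Finset α) (m e : α → ℝ) (he0 : ∀ a ∈ s, 0 ≤ e a) (hem : ∀ a ∈ s, e a ≤ m a) :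
    0 ≤ ∏ a ∈ s, m a - ∏ a ∈ s, (m a - e a) :=
  sub_nonneg.2 (prod_le_prod (fun x hx => sub_nonneg.2 (hem x hx)) (fun x hx => sub_le_self _ (he0 x hx)))

/-- Total weight of the `2^S` leaves: `Σ_ω ∏_σ m_σ(ω_σ) = ∏_σ Σ_b m_σ(b)`. [folklore] -/
theorem sum_leaf_total {S : ℕ} (m : Fin S → Bool → ℝ) :
    ∑ ω : Fin S → Bool, ∏ σ, m σ (ω σ) = ∏ σ : Fin S, ∑ b : Bool, m σ b := by
  rw [Finset.prod_univ_sum (fun _ => (Finset.univ : Finset Bool)) m, Fintype.piFinset_univ]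

/-- Slot factorization over the leaves (the other stages summed out): `Σ_ω e_σ(ω_σ)·∏_{τ≠σ} m_τ(ω_τ) = (Σ_b e_σ b)·∏_{τ≠σ} Σ_b m_τ b`. [folklore] -/
theorem sum_leaf_factor {S : ℕ} (σ : Fin S) (m e : Fin S → Bool → ℝ) :
    ∑ ω : Fin S → Bool, e σ (ω σ) * ∏ τ ∈ univ.erase σ, m τ (ω τ) =
      (∑ b : Bool, e σ b) * ∏ τ ∈ univ.erase σ, ∑ b : Bool, m τ b := by
  have key : ∀ ω : Fin S → Bool, e σ (ω σ) * ∏ τ ∈ univ.erase σ, m τ (ω τ) =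
      ∏ τ, (fun τ b => if τ = σ then e σ b else m τ b) τ (ω τ) := by
    intro ω
    rw [← mul_prod_erase univ _ (mem_univ σ)]
    simp only [if_true]
    congr 1
    exact prod_congr rfl fun τ hτ => by rw [if_neg (ne_of_mem_erase hτ)]
  have key2 : (∑ b : Bool, e σ b) * ∏ τ ∈ univ.erase σ, ∑ b : Bool, m τ b =
      ∏ τ, ∑ b : Bool, (fun τ b => if τ = σ then e σ b else m τ b) τ b := by
    rw [← mul_prod_erase univ _ (mem_univ σ)]
    simp only [if_true]
    congr 1
    exact prod_congr rfl fun τ hτ => by simp only [if_neg (ne_of_mem_erase hτ)]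
  simp_rw [key]
  rw [key2]
  exact sum_leaf_total (fun τ b => if τ = σ then e σ b else m τ b)

end Algebra

/-! ## §2 The abstract product slot system: `S` stages, leaves `Fin S → Bool`, one slot per stage — the constructor fires with `V = S` -/

section Abstract

variable {S : ℕ} (m e : ℕ → ℕ → Fin S → Bool → ℝ)

/-- **THE REALIZED LEDGER OF THE PRODUCT MODEL, FOR EVERY CHOICE FUNCTION** (`SlotLedger.of_realized`, tilt `a = 0`): terms `A(ω) = ∏_σ m(ω_σ)`, shell part
`∏ m − ∏ (m − e)`, slot `σ`'s piece `e_σ(ω_σ)·∏_{τ≠σ} m_τ(ω_τ)`; needs `0 ≤ e ≤ m` and `Σ_b m_σ b = 1`. [folklore] -/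
theorem realizedLedger_product (he0 : ∀ K i σ b, 0 ≤ e K i σ b) (hem : ∀ K i σ b, e K i σ b ≤ m K i σ b)
    (hm1 : ∀ K i σ, ∑ b : Bool, m K i σ b = 1) (l₀ : ℝ) (c : ℕ → ℕ) :
    SlotLedger l₀ (fun _ => (univ : Finset (Fin S → Bool)))
      (fun K => (fun (K i : ℕ) (_ : ℝ) (ω : Fin S → Bool) => ∏ σ, m K i σ (ω σ)) K (c K))
      (fun K => (fun (K i : ℕ) (_ : ℝ) (ω : Fin S → Bool) => ∏ σ, m K i σ (ω σ) - ∏ σ, (m K i σ (ω σ) - e K i σ (ω σ))) K (c K))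
      (fun _ => (univ : Finset (Fin S)))
      (fun K => (fun (K i : ℕ) (_ : ℝ) (σ : Fin S) (ω : Fin S → Bool) => e K i σ (ω σ) * ∏ τ ∈ univ.erase σ, m K i τ (ω τ)) K (c K))
      (fun K s => Real.exp (2 * 0) *
        ((∑ τ ∈ (univ : Finset (Fin S → Bool)), (fun (K i : ℕ) (_ : ℝ) (σ : Fin S) (ω : Fin S → Bool) =>
            e K i σ (ω σ) * ∏ τ ∈ univ.erase σ, m K i τ (ω τ)) K (c K) 0 s τ) /
          ∑ τ ∈ (univ : Finset (Fin S → Bool)), (fun (K i : ℕ) (_ : ℝ) (ω : Fin S → Bool) => ∏ σ, m K i σ (ω σ)) K (c K) 0 τ)) := by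
  have hm0 : ∀ K i σ b, 0 ≤ m K i σ b := fun K i σ b => (he0 K i σ b).trans (hem K i σ b)
  have htot : ∀ K i, ∑ ω : Fin S → Bool, ∏ σ, m K i σ (ω σ) = 1 := by
    intro K i; rw [sum_leaf_total]; exact prod_eq_one fun σ _ => hm1 K i σ
  refine SlotLedger.of_realized (a := 0) ?_ ?_ ?_ ?_ ?_ ?_ ?_
  · intro K t _ ω _
    exact prod_sub_prod_nonneg _ _ _ (fun σ _ => he0 K (c K) σ (ω σ)) (fun σ _ => hem K (c K) σ (ω σ))
  · intro K t _ ω _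
    exact sub_le_self _ (prod_nonneg fun σ _ => sub_nonneg.2 (hem K (c K) σ (ω σ)))
  · intro K t _ ω _
    exact prod_sub_prod_le_sum _ _ _ (fun σ _ => he0 K (c K) σ (ω σ)) (fun σ _ => hem K (c K) σ (ω σ))
  · intro K σ _ ω _
    exact mul_nonneg (he0 K (c K) σ (ω σ)) (prod_nonneg fun τ _ => hm0 K (c K) τ (ω τ))
  · intro K
    rw [htot]; exact one_pos
  · intro K t _ s _
    rw [Real.exp_zero, one_mul]
  · intro K t _
    simp only [Real.exp_zero, one_mul, le_refl]

/-- The candidate-summed shell totals of the product model: `Σ_{i<n} Σ_σ Σ_ω piece = Σ_σ Σ_{i<n} Σ_b e_{K,i,σ}(b) ≤ S·1` when every stage's shell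
masses sum to `≤ 1` over the candidates (disjointness) and `Σ_b m = 1`. [folklore] -/
theorem candidateTotals_product_le (hm1 : ∀ K i σ, ∑ b : Bool, m K i σ b = 1) (n : ℕ → ℕ)
    (hdisj : ∀ K σ, ∑ i ∈ range (n K), ∑ b : Bool, e K i σ b ≤ 1) (K : ℕ) :
    ∑ i ∈ range (n K), ∑ σ ∈ (univ : Finset (Fin S)), ∑ ω ∈ (univ : Finset (Fin S → Bool)),
        (fun (K i : ℕ) (_ : ℝ) (σ : Fin S) (ω : Fin S → Bool) => e K i σ (ω σ) * ∏ τ ∈ univ.erase σ, m K i τ (ω τ)) K i 0 σ ω ≤ (S : ℝ) * 1 := by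
  have e1 : ∀ i σ, ∑ ω ∈ (univ : Finset (Fin S → Bool)),
      (fun (K i : ℕ) (_ : ℝ) (σ : Fin S) (ω : Fin S → Bool) => e K i σ (ω σ) * ∏ τ ∈ univ.erase σ, m K i τ (ω τ)) K i 0 σ ω = ∑ b : Bool, e K i σ b := by
    intro i σ
    show ∑ ω : Fin S → Bool, e K i σ (ω σ) * ∏ τ ∈ univ.erase σ, m K i τ (ω τ) = _
    rw [sum_leaf_factor, prod_eq_one fun τ _ => hm1 K i τ, mul_one]
  simp only [e1]
  rw [sum_comm, mul_one]
  calc ∑ σ ∈ (univ : Finset (Fin S)), ∑ i ∈ range (n K), ∑ b : Bool, e K i σ b ≤ ∑ _σ ∈ (univ : Finset (Fin S)), (1 : ℝ) :=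
        sum_le_sum fun σ _ => hdisj K σ
    _ = S := by rw [sum_const, card_univ, Fintype.card_fin, nsmul_eq_mul, mul_one]

variable (mA eA mB eB : ℕ → ℕ → Fin S → Bool → ℝ)

/-- **THE PRODUCT MODEL FIRES `shellWeightBound_of_liveFactor` WITH `V = S`.**  Two runs' abstract product slot systems (`0 ≤ e^X ≤ m^X`, `Σ_b m^X = 1`,
per stage `Σ_{i<n_K} Σ_b e^X_{K,i,σ} ≤ 1`), `n_K = ⌊β′∕(c₁ϑ^K)⌋₊` candidates (`0 < c₁`, `2c₁ ≤ β′`, `0 < ϑ < 1`), any `S` (also `S = 0`): ONE choice function `i⋆` with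
`T4IndicatorShell.ShellWeightBound` BY NAME for the two runs written with the common factor of index `i⋆ K`, `Wsh K` = the two runs' total chosen shell masses
`Σ_σ Σ_b e^A_{K,i⋆K,σ}(b) + Σ_σ Σ_b e^B_{K,i⋆K,σ}(b)` (the realized ledgers' `ω^A + ω^B`; inside the constructor `≤ 2·S·(4c₁∕β′)·ϑ^K`). [folklore] -/
theorem shellWeightBound_productStages (l₀ : ℝ) {c₁ β' ϑ : ℝ} (hc₁ : 0 < c₁) (h2 : 2 * c₁ ≤ β') (hϑ0 : 0 < ϑ) (hϑ1 : ϑ < 1)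
    (hA0 : ∀ K i σ b, 0 ≤ eA K i σ b) (hAle : ∀ K i σ b, eA K i σ b ≤ mA K i σ b) (hA1 : ∀ K i σ, ∑ b : Bool, mA K i σ b = 1)
    (hAdisj : ∀ K σ, ∑ i ∈ range ⌊β' / (c₁ * ϑ ^ K)⌋₊, ∑ b : Bool, eA K i σ b ≤ 1)
    (hB0 : ∀ K i σ b, 0 ≤ eB K i σ b) (hBle : ∀ K i σ b, eB K i σ b ≤ mB K i σ b) (hB1 : ∀ K i σ, ∑ b : Bool, mB K i σ b = 1)
    (hBdisj : ∀ K σ, ∑ i ∈ range ⌊β' / (c₁ * ϑ ^ K)⌋₊, ∑ b : Bool, eB K i σ b ≤ 1) :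
    ∃ istar : ℕ → ℕ, (∀ K, istar K < ⌊β' / (c₁ * ϑ ^ K)⌋₊) ∧
      T4IndicatorShell.ShellWeightBound l₀ (fun _ => (univ : Finset (Fin S → Bool)))
        (fun K => (fun (K i : ℕ) (_ : ℝ) (ω : Fin S → Bool) => ∏ σ, mA K i σ (ω σ)) K (istar K))
        (fun K => (fun (K i : ℕ) (_ : ℝ) (ω : Fin S → Bool) => ∏ σ, mB K i σ (ω σ)) K (istar K))
        (fun K => (fun (K i : ℕ) (_ : ℝ) (ω : Fin S → Bool) => ∏ σ, mA K i σ (ω σ) - ∏ σ, (mA K i σ (ω σ) - eA K i σ (ω σ))) K (istar K))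
        (fun K => (fun (K i : ℕ) (_ : ℝ) (ω : Fin S → Bool) => ∏ σ, mB K i σ (ω σ) - ∏ σ, (mB K i σ (ω σ) - eB K i σ (ω σ))) K (istar K))
        (fun K => ∑ σ : Fin S, ∑ b : Bool, eA K (istar K) σ b + ∑ σ : Fin S, ∑ b : Bool, eB K (istar K) σ b) := by
  -- the candidate count at rate `c₁ϑ^K`
  have hrate : ∀ K, 0 < ⌊β' / (c₁ * ϑ ^ K)⌋₊ ∧ (2 : ℝ) / ⌊β' / (c₁ * ϑ ^ K)⌋₊ ≤ (4 * c₁ / β') * ϑ ^ K := by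
    intro K
    have hρ : 0 < c₁ * ϑ ^ K := mul_pos hc₁ (pow_pos hϑ0 K)
    have hρ2 : 2 * (c₁ * ϑ ^ K) ≤ β' := by nlinarith [pow_le_one₀ hϑ0.le hϑ1.le (n := K)]
    obtain ⟨h1, -, h3⟩ := candidateCount_spec hρ hρ2
    exact ⟨h1, h3.trans_eq (by ring)⟩
  have hlA := fun c => realizedLedger_product mA eA hA0 hAle hA1 l₀ c
  have hlB := fun c => realizedLedger_product mB eB hB0 hBle hB1 l₀ c
  have htotA : ∀ K i, ∑ ω : Fin S → Bool, ∏ σ, mA K i σ (ω σ) = 1 := by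
    intro K i; rw [sum_leaf_total]; exact prod_eq_one fun σ _ => hA1 K i σ
  have htotB : ∀ K i, ∑ ω : Fin S → Bool, ∏ σ, mB K i σ (ω σ) = 1 := by
    intro K i; rw [sum_leaf_total]; exact prod_eq_one fun σ _ => hB1 K i σ
  have hmA0 : ∀ K i σ b, 0 ≤ mA K i σ b := fun K i σ b => (hA0 K i σ b).trans (hAle K i σ b)
  have hmB0 : ∀ K i σ b, 0 ≤ mB K i σ b := fun K i σ b => (hB0 K i σ b).trans (hBle K i σ b)
  obtain ⟨istar, hlt, hSWB⟩ := shellWeightBound_of_liveFactor (l₀ := l₀) (a := 0) (ϑ := ϑ) (V := (S : ℝ)) (M := 4 * c₁ / β')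
    (T := fun _ => (univ : Finset (Fin S → Bool)))
    (A := fun (K i : ℕ) (_ : ℝ) (ω : Fin S → Bool) => ∏ σ, mA K i σ (ω σ))
    (B := fun (K i : ℕ) (_ : ℝ) (ω : Fin S → Bool) => ∏ σ, mB K i σ (ω σ))
    (shA := fun (K i : ℕ) (_ : ℝ) (ω : Fin S → Bool) => ∏ σ, mA K i σ (ω σ) - ∏ σ, (mA K i σ (ω σ) - eA K i σ (ω σ)))
    (shB := fun (K i : ℕ) (_ : ℝ) (ω : Fin S → Bool) => ∏ σ, mB K i σ (ω σ) - ∏ σ, (mB K i σ (ω σ) - eB K i σ (ω σ)))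
    (SA := fun _ => (univ : Finset (Fin S))) (SB := fun _ => (univ : Finset (Fin S)))
    (pieceA := fun (K i : ℕ) (_ : ℝ) (σ : Fin S) (ω : Fin S → Bool) => eA K i σ (ω σ) * ∏ τ ∈ univ.erase σ, mA K i τ (ω τ))
    (pieceB := fun (K i : ℕ) (_ : ℝ) (σ : Fin S) (ω : Fin S → Bool) => eB K i σ (ω σ) * ∏ τ ∈ univ.erase σ, mB K i τ (ω τ))
    (fun K => ⌊β' / (c₁ * ϑ ^ K)⌋₊) (fun K => (hrate K).1) hlA hlB
    (fun K i => sum_nonneg fun σ _ => sum_nonneg fun ω _ =>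
      mul_nonneg (hA0 K i σ (ω σ)) (prod_nonneg fun τ _ => hmA0 K i τ (ω τ)))
    (fun K i => sum_nonneg fun σ _ => sum_nonneg fun ω _ =>
      mul_nonneg (hB0 K i σ (ω σ)) (prod_nonneg fun τ _ => hmB0 K i τ (ω τ)))
    (ZA := fun _ => 1) (ZB := fun _ => 1) (fun _ => one_pos) (fun _ => one_pos)
    (fun K i => (htotA K i).symm.le) (fun K i => (htotB K i).symm.le)
    (Nat.cast_nonneg S)
    (fun K => candidateTotals_product_le mA eA hA1 (fun K => ⌊β' / (c₁ * ϑ ^ K)⌋₊) hAdisj K)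
    (fun K => candidateTotals_product_le mB eB hB1 (fun K => ⌊β' / (c₁ * ϑ ^ K)⌋₊) hBdisj K)
    (fun K => (hrate K).2) hϑ0.le hϑ1
  refine ⟨istar, hlt, ?_⟩
  have e : (fun K => (hlA istar).omega K + (hlB istar).omega K) =
      (fun K => ∑ σ : Fin S, ∑ b : Bool, eA K (istar K) σ b + ∑ σ : Fin S, ∑ b : Bool, eB K (istar K) σ b) := by
    funext K
    simp only [SlotLedger.omega, mul_zero, Real.exp_zero, one_mul]
    rw [htotA, htotB]
    simp only [div_one]
    congr 1
    · exact sum_congr rfl fun σ _ => by rw [sum_leaf_factor, prod_eq_one fun τ _ => hA1 K _ τ, mul_one]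
    · exact sum_congr rfl fun σ _ => by rw [sum_leaf_factor, prod_eq_one fun τ _ => hB1 K _ τ, mul_one]
  rw [← e]
  exact hSWB

end Abstract

/-! ## §3 The measure instance: `S` independent tests with ANY laws, two-sided shells -/

section MeasureInstance

variable {S : ℕ} (μA μB : Fin S → Measure ℝ) [∀ σ, IsProbabilityMeasure (μA σ)] [∀ σ, IsProbabilityMeasure (μB σ)]
  (θ : ℕ → Fin S → ℝ) (ρA ρB : ℕ → Fin S → ℝ)

/-- One stage's laws: the side masses sum to `1` and the two shell halves to the mass of the tree's `twoSidedShell`; over the candidates the latter sum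
to `≤ 1` (`twoSidedShell_disjoint`; `0 ≤ θ`, `0 ≤ ρ`, `2ρ ≤ ρ⋆ ≤ 1`). [folklore] -/
theorem stage_masses (μ : Measure ℝ) [IsProbabilityMeasure μ] {θ ρ ρstar : ℝ} (hθ : 0 ≤ θ) (hρ0 : 0 ≤ ρ) (h2 : 2 * ρ ≤ ρstar) (h1 : ρstar ≤ 1)
    (n : ℕ) :
    (∀ i : ℕ, ∑ b : Bool, (if b then μ.real (Iio (θ * (1 - ρstar) ^ i)) else μ.real (Ici (θ * (1 - ρstar) ^ i))) = 1) ∧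
    ∑ i ∈ range n, ∑ b : Bool, (if b then μ.real (Ico (θ * (1 - ρstar) ^ i * (1 - ρ)) (θ * (1 - ρstar) ^ i))
        else μ.real (Ico (θ * (1 - ρstar) ^ i) (θ * (1 - ρstar) ^ i * (1 + ρ)))) ≤ 1 := by
  constructor
  · intro i
    rw [Fintype.sum_bool]
    simp only [if_true, Bool.false_eq_true, if_false]
    rw [← compl_Iio, measureReal_compl measurableSet_Iio, probReal_univ]; ring
  · have e : ∀ i, ∑ b : Bool, (if b then μ.real (Ico (θ * (1 - ρstar) ^ i * (1 - ρ)) (θ * (1 - ρstar) ^ i))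
        else μ.real (Ico (θ * (1 - ρstar) ^ i) (θ * (1 - ρstar) ^ i * (1 + ρ)))) = μ.real (twoSidedShell θ ρstar ρ i) := by
      intro i
      have h0 : 0 ≤ θ * (1 - ρstar) ^ i := mul_nonneg hθ (pow_nonneg (by linarith) _)
      rw [Fintype.sum_bool]
      simp only [if_true, Bool.false_eq_true, if_false]
      rw [twoSidedShell, ← Ico_union_Ico_eq_Ico (mul_le_of_le_one_right h0 (by linarith)) (le_mul_of_one_le_right h0 (by linarith)),
        measureReal_union (Ico_disjoint_Ico_same) measurableSet_Ico]
    simp only [e]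
    calc ∑ i ∈ range n, μ.real (twoSidedShell θ ρstar ρ i)
        = μ.real (⋃ i ∈ range n, twoSidedShell θ ρstar ρ i) := by
          rw [measureReal_biUnion_finset (fun i _ j _ hij => twoSidedShell_disjoint hθ hρ0 h2 h1 hij) (fun i _ => measurableSet_Ico)]
      _ ≤ μ.real (univ : Set ℝ) := measureReal_mono (subset_univ _)
      _ = 1 := probReal_univ

/-- **THE `S`-STAGE MEASURE MODEL FIRES THE CONSTRUCTOR, FOR ANY LAWS.**  Stage `σ` of run `X` tests a real variable with law `μ^X_σ` (ANY probability measure)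
against `θ_{K,σ}(1 − c₁ϑ^K)^i`; `0 ≤ θ`, widths `0 ≤ ρ^X_{K,σ}`, `2ρ^X_{K,σ} ≤ c₁ϑ^K`, `0 < c₁`, `2c₁ ≤ β′ ≤ 1`, `0 < ϑ < 1`, any `S`.  Then ONE choice function
`i⋆` gives `ShellWeightBound` BY NAME for the two product runs with `Wsh K = Σ_σ Σ_b e^A + Σ_σ Σ_b e^B` = the two runs' total chosen two-sided shell masses;
consumed of the laws: `Σ_i μ^X_σ(twoSidedShell_i) ≤ 1` per stage — disjointness alone. [folklore] -/
theorem shellWeightBound_productStages_measure (l₀ : ℝ) {c₁ β' ϑ : ℝ} (hc₁ : 0 < c₁) (h2 : 2 * c₁ ≤ β') (hβ1 : β' ≤ 1)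
    (hϑ0 : 0 < ϑ) (hϑ1 : ϑ < 1) (hθ : ∀ K σ, 0 ≤ θ K σ)
    (hA0 : ∀ K σ, 0 ≤ ρA K σ) (hA2 : ∀ K σ, 2 * ρA K σ ≤ c₁ * ϑ ^ K) (hB0 : ∀ K σ, 0 ≤ ρB K σ) (hB2 : ∀ K σ, 2 * ρB K σ ≤ c₁ * ϑ ^ K) :
    ∃ istar : ℕ → ℕ, (∀ K, istar K < ⌊β' / (c₁ * ϑ ^ K)⌋₊) ∧
      T4IndicatorShell.ShellWeightBound l₀ (fun _ => (univ : Finset (Fin S → Bool)))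
        (fun K => (fun (K i : ℕ) (_ : ℝ) (ω : Fin S → Bool) => ∏ σ, (fun (K i : ℕ) (σ : Fin S) (b : Bool) =>
          if b then (μA σ).real (Iio (θ K σ * (1 - c₁ * ϑ ^ K) ^ i)) else (μA σ).real (Ici (θ K σ * (1 - c₁ * ϑ ^ K) ^ i))) K i σ (ω σ)) K (istar K))
        (fun K => (fun (K i : ℕ) (_ : ℝ) (ω : Fin S → Bool) => ∏ σ, (fun (K i : ℕ) (σ : Fin S) (b : Bool) =>
          if b then (μB σ).real (Iio (θ K σ * (1 - c₁ * ϑ ^ K) ^ i)) else (μB σ).real (Ici (θ K σ * (1 - c₁ * ϑ ^ K) ^ i))) K i σ (ω σ)) K (istar K))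
        (fun K => (fun (K i : ℕ) (_ : ℝ) (ω : Fin S → Bool) =>
          ∏ σ, (fun (K i : ℕ) (σ : Fin S) (b : Bool) =>
              if b then (μA σ).real (Iio (θ K σ * (1 - c₁ * ϑ ^ K) ^ i)) else (μA σ).real (Ici (θ K σ * (1 - c₁ * ϑ ^ K) ^ i))) K i σ (ω σ) -
          ∏ σ, ((fun (K i : ℕ) (σ : Fin S) (b : Bool) =>
              if b then (μA σ).real (Iio (θ K σ * (1 - c₁ * ϑ ^ K) ^ i)) else (μA σ).real (Ici (θ K σ * (1 - c₁ * ϑ ^ K) ^ i))) K i σ (ω σ) -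
            (fun (K i : ℕ) (σ : Fin S) (b : Bool) =>
              if b then (μA σ).real (Ico (θ K σ * (1 - c₁ * ϑ ^ K) ^ i * (1 - ρA K σ)) (θ K σ * (1 - c₁ * ϑ ^ K) ^ i))
              else (μA σ).real (Ico (θ K σ * (1 - c₁ * ϑ ^ K) ^ i) (θ K σ * (1 - c₁ * ϑ ^ K) ^ i * (1 + ρA K σ)))) K i σ (ω σ))) K (istar K))
        (fun K => (fun (K i : ℕ) (_ : ℝ) (ω : Fin S → Bool) =>
          ∏ σ, (fun (K i : ℕ) (σ : Fin S) (b : Bool) =>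
              if b then (μB σ).real (Iio (θ K σ * (1 - c₁ * ϑ ^ K) ^ i)) else (μB σ).real (Ici (θ K σ * (1 - c₁ * ϑ ^ K) ^ i))) K i σ (ω σ) -
          ∏ σ, ((fun (K i : ℕ) (σ : Fin S) (b : Bool) =>
              if b then (μB σ).real (Iio (θ K σ * (1 - c₁ * ϑ ^ K) ^ i)) else (μB σ).real (Ici (θ K σ * (1 - c₁ * ϑ ^ K) ^ i))) K i σ (ω σ) -
            (fun (K i : ℕ) (σ : Fin S) (b : Bool) =>
              if b then (μB σ).real (Ico (θ K σ * (1 - c₁ * ϑ ^ K) ^ i * (1 - ρB K σ)) (θ K σ * (1 - c₁ * ϑ ^ K) ^ i))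
              else (μB σ).real (Ico (θ K σ * (1 - c₁ * ϑ ^ K) ^ i) (θ K σ * (1 - c₁ * ϑ ^ K) ^ i * (1 + ρB K σ)))) K i σ (ω σ))) K (istar K))
        (fun K => ∑ σ : Fin S, (μA σ).real (twoSidedShell (θ K σ) (c₁ * ϑ ^ K) (ρA K σ) (istar K)) +
          ∑ σ : Fin S, (μB σ).real (twoSidedShell (θ K σ) (c₁ * ϑ ^ K) (ρB K σ) (istar K))) := by
  have hs1 : ∀ K, c₁ * ϑ ^ K ≤ 1 := fun K => by
    have := mul_le_mul_of_nonneg_left (pow_le_one₀ hϑ0.le hϑ1.le : ϑ ^ K ≤ 1) hc₁.le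
    linarith
  have stA := fun K σ => stage_masses (μA σ) (hθ K σ) (hA0 K σ) (hA2 K σ) (hs1 K) ⌊β' / (c₁ * ϑ ^ K)⌋₊
  have stB := fun K σ => stage_masses (μB σ) (hθ K σ) (hB0 K σ) (hB2 K σ) (hs1 K) ⌊β' / (c₁ * ϑ ^ K)⌋₊
  obtain ⟨istar, hlt, h⟩ := shellWeightBound_productStages
    (fun (K i : ℕ) (σ : Fin S) (b : Bool) =>
      if b then (μA σ).real (Iio (θ K σ * (1 - c₁ * ϑ ^ K) ^ i)) else (μA σ).real (Ici (θ K σ * (1 - c₁ * ϑ ^ K) ^ i)))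
    (fun (K i : ℕ) (σ : Fin S) (b : Bool) =>
      if b then (μA σ).real (Ico (θ K σ * (1 - c₁ * ϑ ^ K) ^ i * (1 - ρA K σ)) (θ K σ * (1 - c₁ * ϑ ^ K) ^ i))
      else (μA σ).real (Ico (θ K σ * (1 - c₁ * ϑ ^ K) ^ i) (θ K σ * (1 - c₁ * ϑ ^ K) ^ i * (1 + ρA K σ))))
    (fun (K i : ℕ) (σ : Fin S) (b : Bool) =>
      if b then (μB σ).real (Iio (θ K σ * (1 - c₁ * ϑ ^ K) ^ i)) else (μB σ).real (Ici (θ K σ * (1 - c₁ * ϑ ^ K) ^ i)))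
    (fun (K i : ℕ) (σ : Fin S) (b : Bool) =>
      if b then (μB σ).real (Ico (θ K σ * (1 - c₁ * ϑ ^ K) ^ i * (1 - ρB K σ)) (θ K σ * (1 - c₁ * ϑ ^ K) ^ i))
      else (μB σ).real (Ico (θ K σ * (1 - c₁ * ϑ ^ K) ^ i) (θ K σ * (1 - c₁ * ϑ ^ K) ^ i * (1 + ρB K σ))))
    l₀ hc₁ h2 hϑ0 hϑ1
    (fun K i σ b => by cases b <;> exact measureReal_nonneg)
    (fun K i σ b => by
      cases b
      · simp only [Bool.false_eq_true, if_false]; exact measureReal_mono (fun x hx => mem_Ici.2 hx.1)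
      · simp only [if_true]; exact measureReal_mono (fun x hx => hx.2))
    (fun K i σ => (stA K σ).1 i) (fun K σ => (stA K σ).2)
    (fun K i σ b => by cases b <;> exact measureReal_nonneg)
    (fun K i σ b => by
      cases b
      · simp only [Bool.false_eq_true, if_false]; exact measureReal_mono (fun x hx => mem_Ici.2 hx.1)
      · simp only [if_true]; exact measureReal_mono (fun x hx => hx.2))
    (fun K i σ => (stB K σ).1 i) (fun K σ => (stB K σ).2)
  refine ⟨istar, hlt, ?_⟩
  have eA : ∀ K σ, ∑ b : Bool, (fun (K i : ℕ) (σ : Fin S) (b : Bool) =>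
      if b then (μA σ).real (Ico (θ K σ * (1 - c₁ * ϑ ^ K) ^ i * (1 - ρA K σ)) (θ K σ * (1 - c₁ * ϑ ^ K) ^ i))
      else (μA σ).real (Ico (θ K σ * (1 - c₁ * ϑ ^ K) ^ i) (θ K σ * (1 - c₁ * ϑ ^ K) ^ i * (1 + ρA K σ)))) K (istar K) σ b =
      (μA σ).real (twoSidedShell (θ K σ) (c₁ * ϑ ^ K) (ρA K σ) (istar K)) := by
    intro K σ
    have h0 : 0 ≤ θ K σ * (1 - c₁ * ϑ ^ K) ^ istar K := mul_nonneg (hθ K σ) (pow_nonneg (by linarith [hs1 K]) _)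
    rw [Fintype.sum_bool]
    simp only [if_true, Bool.false_eq_true, if_false]
    rw [twoSidedShell, ← Ico_union_Ico_eq_Ico (mul_le_of_le_one_right h0 (by linarith [hA0 K σ])) (le_mul_of_one_le_right h0 (by linarith [hA0 K σ])),
      measureReal_union (Ico_disjoint_Ico_same) measurableSet_Ico]
  have eB : ∀ K σ, ∑ b : Bool, (fun (K i : ℕ) (σ : Fin S) (b : Bool) =>
      if b then (μB σ).real (Ico (θ K σ * (1 - c₁ * ϑ ^ K) ^ i * (1 - ρB K σ)) (θ K σ * (1 - c₁ * ϑ ^ K) ^ i))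
      else (μB σ).real (Ico (θ K σ * (1 - c₁ * ϑ ^ K) ^ i) (θ K σ * (1 - c₁ * ϑ ^ K) ^ i * (1 + ρB K σ)))) K (istar K) σ b =
      (μB σ).real (twoSidedShell (θ K σ) (c₁ * ϑ ^ K) (ρB K σ) (istar K)) := by
    intro K σ
    have h0 : 0 ≤ θ K σ * (1 - c₁ * ϑ ^ K) ^ istar K := mul_nonneg (hθ K σ) (pow_nonneg (by linarith [hs1 K]) _)
    rw [Fintype.sum_bool]
    simp only [if_true, Bool.false_eq_true, if_false]
    rw [twoSidedShell, ← Ico_union_Ico_eq_Ico (mul_le_of_le_one_right h0 (by linarith [hB0 K σ])) (le_mul_of_one_le_right h0 (by linarith [hB0 K σ])),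
      measureReal_union (Ico_disjoint_Ico_same) measurableSet_Ico]
  have e : (fun K => ∑ σ : Fin S, ∑ b : Bool, (fun (K i : ℕ) (σ : Fin S) (b : Bool) =>
      if b then (μA σ).real (Ico (θ K σ * (1 - c₁ * ϑ ^ K) ^ i * (1 - ρA K σ)) (θ K σ * (1 - c₁ * ϑ ^ K) ^ i))
      else (μA σ).real (Ico (θ K σ * (1 - c₁ * ϑ ^ K) ^ i) (θ K σ * (1 - c₁ * ϑ ^ K) ^ i * (1 + ρA K σ)))) K (istar K) σ b +
      ∑ σ : Fin S, ∑ b : Bool, (fun (K i : ℕ) (σ : Fin S) (b : Bool) =>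
      if b then (μB σ).real (Ico (θ K σ * (1 - c₁ * ϑ ^ K) ^ i * (1 - ρB K σ)) (θ K σ * (1 - c₁ * ϑ ^ K) ^ i))
      else (μB σ).real (Ico (θ K σ * (1 - c₁ * ϑ ^ K) ^ i) (θ K σ * (1 - c₁ * ϑ ^ K) ^ i * (1 + ρB K σ)))) K (istar K) σ b) =
      (fun K => ∑ σ : Fin S, (μA σ).real (twoSidedShell (θ K σ) (c₁ * ϑ ^ K) (ρA K σ) (istar K)) +
          ∑ σ : Fin S, (μB σ).real (twoSidedShell (θ K σ) (c₁ * ϑ ^ K) (ρB K σ) (istar K))) := by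
    funext K
    rw [sum_congr rfl fun σ _ => eA K σ, sum_congr rfl fun σ _ => eB K σ]
  rw [← e]
  exact h

end MeasureInstance

end Summit.QuantumFields.BalabanUV.T4Continuum.Spine.NE7c.LiveFactorProductStageModel

end
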